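import Summits.Ventures.GridStability.Bench.WSCC9KBox
import Summits.Ventures.GridStability.Models.SwingTubeTrig

/-!
# WSCC9KBoxAnySide — the «K ⊂ S» kernel test WITHOUT the side condition «box below the equilibrium angle» (legs ≥ 25 of the 36-leg tube)

Venture GRIDFUSION (LADDER-GRIDFUSION G1-cct, next-wave «∀T» successor of «#61‴»; seat gridfusion-model-1 g6, on sos-1 g8's kernel-side
datum 13:33:24Z: «sos-3's `KBox.zbox` (sideOK: `c_i ≤ cosLoQ a_i^hi`, the box lies BELOW the post-fault SEP angle so `κ_i` is monotone) holds
for legs ≤ 24 only — leg 25 STRADDLES `a₂*`, legs ≥ 26 are above it; a ∀T ≥ 1/8 s closer needs a 3-case zbox lemma»).  NO CASES ARE NEEDED: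
`σ_i = sin u_i = c_i sin a_i − s_i cos a_i` and `1 − κ_i = cos u_i = s_i sin a_i + c_i cos a_i` are coupling terms `C sin a + D cos a`, so the
MONOTONICITY-AWARE term enclosure of the generic tube integrator (`Models.SwingTube.termLo/termHi`, `term_mem`: derivative interval test,
endpoint values when monotone, naive ranges otherwise; valid for `a ∈ [lo, hi] ⊆ [−3, 3]`) encloses them on ANY angle box — below,
straddling or above `α_i*`.  CONTENTS (mirror of `Bench/WSCC9KBox` §2 with the side condition replaced by `−3/2 ≤ a_lo ≤ a_hi ≤ 3`):
`KBox.sigIG/kapIG/zboxG`, `KBox.sideOKG`, `KBox.checkLeG B V c` (ONE `decide`), soundness `KBox.sig_kap_memG`, `KBox.Z_mem_zboxG`,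
`KBox.eval_le_of_checkLeG` (`checkLeG ⇒ V(Z δs x) ≤ c` on the box, any `δs` with `EqData δs`), `KBox.abs_u_lt_pi_G`.  Same recast embedding
`deg2_A_SPdampH12_Z` and variable order `(σ₂, κ₂, σ₃, κ₃, v₁, v₂, v₃)`; intervals dyadically rounded (`roundOut 60`).  THREE COLUMNS:
CERTIFIED = these kernel lemmas (pure inequalities); nothing VALIDATED; MODELLED = instance «WSCC9-postB-SPdamp-h12».  No stability sentence.
[cite: Moore1979, §3.3 Corollary 3.1 (natural interval extension; monotonicity form)]
-/

noncomputable section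

open Real Set Filter Topology
open Literature.Computation.Certificates Literature.Computation.Certificates.SOS
open Summit.Ventures.GridStability.Models Summit.Ventures.GridStability.Lyapunov

namespace Summit.Ventures.GridStability.Bench.WSCC9

namespace KBox

open Summit.Ventures.GridStability.Models.SwingTube (termLo termHi term_mem)

/-- Sign-free enclosure of `σ = sin (a − α) = c sin a − s cos a` over `a ∈ [alo, ahi] ⊆ [−3, 3]`, dyadically rounded. [folklore] -/
def sigIG (s c alo ahi : ℚ) : NonemptyInterval ℚ :=
  (mkI (termLo c (-s) alo ahi) (termHi c (-s) alo ahi)).roundOut 60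

/-- Sign-free enclosure of `κ = 1 − cos (a − α) = 1 − (s sin a + c cos a)` over `a ∈ [alo, ahi] ⊆ [−3, 3]`, rounded. [folklore] -/
def kapIG (s c alo ahi : ℚ) : NonemptyInterval ℚ :=
  (mkI (1 - termHi s c alo ahi) (1 - termLo s c alo ahi)).roundOut 60

/-- The recast 7-box of a K-box WITHOUT side condition, variable order `(σ₂, κ₂, σ₃, κ₃, v₁, v₂, v₃)`. [folklore] -/
def zboxG (B : KBox) : List (NonemptyInterval ℚ) :=
  [sigIG (WSCC9.postB_SPdamp.s 1) (WSCC9.postB_SPdamp.c 1) B.a2lo B.a2hi,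
   kapIG (WSCC9.postB_SPdamp.s 1) (WSCC9.postB_SPdamp.c 1) B.a2lo B.a2hi,
   sigIG (WSCC9.postB_SPdamp.s 2) (WSCC9.postB_SPdamp.c 2) B.a3lo B.a3hi,
   kapIG (WSCC9.postB_SPdamp.s 2) (WSCC9.postB_SPdamp.c 2) B.a3lo B.a3hi,
   mkI (B.vlo 0) (B.vhi 0), mkI (B.vlo 1) (B.vhi 1), mkI (B.vlo 2) (B.vhi 2)]

/-- The only side condition left: the angle boxes lie in `[−3/2, 3]` (range of the trig enclosures and `|u_i| < π`). [folklore] -/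
def sideOKG (B : KBox) : Bool :=
  decide (-3 / 2 ≤ B.a2lo) && decide (B.a2lo ≤ B.a2hi) && decide (B.a2hi ≤ 3) &&
  decide (-3 / 2 ≤ B.a3lo) && decide (B.a3lo ≤ B.a3hi) && decide (B.a3hi ≤ 3)

/-- The kernel test: side condition and `sup` of the natural interval extension of `V` over the sign-free recast box `≤ c`. [folklore] -/
def checkLeG (B : KBox) (V : Poly) (c : ℚ) : Bool :=
  B.sideOKG && decide ((Poly.iencl B.zboxG V).snd ≤ c)

/-- Sign-free enclosure of `sin (a − α)` and `1 − cos (a − α)` for `a ∈ [alo, ahi] ⊆ [−3, 3]`, `sin α = s`, `cos α = c`. [folklore] -/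
theorem sig_kap_memG {s c alo ahi : ℚ} {α a : ℝ} (hsin : sin α = s) (hcos : cos α = c)
    (h0 : -3 ≤ alo) (h1 : ahi ≤ 3) (ha1 : (alo : ℝ) ≤ a) (ha2 : a ≤ ahi) :
    sin (a - α) ∈ (sigIG s c alo ahi).ratCast ℝ ∧ 1 - cos (a - α) ∈ (kapIG s c alo ahi).ratCast ℝ := by
  have e1 : sin (a - α) = (c : ℝ) * sin a + ((-s : ℚ) : ℝ) * cos a := by rw [Real.sin_sub, hsin, hcos]; push_cast; ring
  have e2 : cos (a - α) = (s : ℝ) * sin a + (c : ℝ) * cos a := by rw [Real.cos_sub, hsin, hcos]; ring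
  have t1 := term_mem (C := c) (D := -s) h0 h1 ha1 ha2
  have t2 := term_mem (C := s) (D := c) h0 h1 ha1 ha2
  constructor
  · apply NonemptyInterval.mem_roundOut
    apply mem_mkI
    · rw [e1]; exact t1.1
    · rw [e1]; exact t1.2
  · apply NonemptyInterval.mem_roundOut
    apply mem_mkI
    · push_cast; rw [e2]; linarith [t2.2]
    · push_cast; rw [e2]; linarith [t2.1]

/-- Unpacking `sideOKG`. [folklore] -/
theorem sideOKG_spec {B : KBox} (h : B.sideOKG = true) :
    (-3 / 2 ≤ B.a2lo ∧ B.a2lo ≤ B.a2hi ∧ B.a2hi ≤ 3) ∧ (-3 / 2 ≤ B.a3lo ∧ B.a3lo ≤ B.a3hi ∧ B.a3hi ≤ 3) := by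
  simp only [sideOKG, Bool.and_eq_true, decide_eq_true_eq] at h
  obtain ⟨⟨⟨⟨⟨h1, h2⟩, h3⟩, h4⟩, h5⟩, h6⟩ := h
  exact ⟨⟨h1, h2, h3⟩, ⟨h4, h5, h6⟩⟩

/-- **The recast state of every `x ∈ B` lies in `zboxG B`** (coordinatewise), for every `δs` with `EqData δs`, provided `sideOKG`
— no «below the equilibrium» condition. [folklore] -/
theorem Z_mem_zboxG (B : KBox) (hside : B.sideOKG = true) {δs : Fin 3 → ℝ} (hEq : WSCC9.postB_SPdamp.EqData δs)
    {x : ClassicalSwing.State 3} (hx : x ∈ B.toSet) (j : ℕ) :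
    vars (List.ofFn (deg2_A_SPdampH12_Z δs x)) j ∈ ((B.zboxG).getD j (NonemptyInterval.pure (0 : ℚ))).ratCast ℝ := by
  obtain ⟨⟨h20, -, h22⟩, ⟨h30, -, h32⟩⟩ := sideOKG_spec hside
  obtain ⟨⟨ha2l, ha2u⟩, ⟨ha3l, ha3u⟩, hv⟩ := (B.mem_toSet_iff x).1 hx
  obtain ⟨-, -, hsin2, hcos2, -⟩ := angleOf_mem 0
  obtain ⟨-, -, hsin3, hcos3, -⟩ := angleOf_mem 1
  have e2 := sin_cos_u_eq hEq x 0
  have e3 := sin_cos_u_eq hEq x 1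
  simp only [Fin.succ_zero_eq_one] at e2 hsin2 hcos2
  simp only [Fin.succ_one_eq_two] at e3 hsin3 hcos3
  have k2 := sig_kap_memG hsin2 hcos2 (by linarith) h22 ha2l ha2u
  have k3 := sig_kap_memG hsin3 hcos3 (by linarith) h32 ha3l ha3u
  refine vars_mem_getD _ _ (by simp [zboxG]) ?_ j
  intro i hi
  have hi7 : i < 7 := by simpa using hi
  interval_cases i
  · simpa [zboxG, e2.1] using k2.1
  · simpa [zboxG, e2.2] using k2.2
  · simpa [zboxG, e3.1] using k3.1
  · simpa [zboxG, e3.2] using k3.2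
  · simpa [zboxG] using mem_mkI (hv 0).1 (hv 0).2
  · simpa [zboxG] using mem_mkI (hv 1).1 (hv 1).2
  · simpa [zboxG] using mem_mkI (hv 2).1 (hv 2).2

/-- **Soundness of the sign-free kernel test.** `checkLeG B V c ⇒ V ≤ c` at the recast state of every `x ∈ B` (any `δs` with `EqData δs`).
[folklore] -/
theorem eval_le_of_checkLeG (B : KBox) {V : Poly} {c : ℚ} (h : B.checkLeG V c = true) {δs : Fin 3 → ℝ}
    (hEq : WSCC9.postB_SPdamp.EqData δs) {x : ClassicalSwing.State 3} (hx : x ∈ B.toSet) :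
    Poly.eval (vars (List.ofFn (deg2_A_SPdampH12_Z δs x))) V ≤ (c : ℝ) := by
  simp only [checkLeG, Bool.and_eq_true, decide_eq_true_eq] at h
  exact Poly.eval_le_of_iencl (Z_mem_zboxG B h.1 hEq hx) V h.2

/-- **No pole-slip window on a `sideOKG` box**: with the canonical angles, `|u_i| < π` for every state of the box
(`u_i ∈ [−3/2 − π/2, 3] ⊂ (−π, π)`). [folklore] -/
theorem abs_u_lt_pi_G (B : KBox) (hside : B.sideOKG = true) {x : ClassicalSwing.State 3} (hx : x ∈ B.toSet) (i : Fin 2) :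
    |RecastData.u WSCC9.postB_SPdamp.angleOf x i.succ| < π := by
  obtain ⟨⟨h20, -, h22⟩, ⟨h30, -, h32⟩⟩ := sideOKG_spec hside
  obtain ⟨⟨ha2l, ha2u⟩, ⟨ha3l, ha3u⟩, -⟩ := (B.mem_toSet_iff x).1 hx
  obtain ⟨hα0, hαπ, -, -, -⟩ := angleOf_mem i
  have hπ := Real.pi_gt_d2
  rw [abs_lt]
  fin_cases i
  · change -π < RecastData.u WSCC9.postB_SPdamp.angleOf x 1 ∧ RecastData.u WSCC9.postB_SPdamp.angleOf x 1 < π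
    change 0 ≤ WSCC9.postB_SPdamp.angleOf 1 at hα0
    change WSCC9.postB_SPdamp.angleOf 1 ≤ π / 2 at hαπ
    simp only [RecastData.u, angleOf_zero, sub_zero]
    have : (-3 / 2 : ℝ) ≤ B.a2lo := by exact_mod_cast h20
    have : (B.a2hi : ℝ) ≤ 3 := by exact_mod_cast h22
    constructor <;> linarith
  · change -π < RecastData.u WSCC9.postB_SPdamp.angleOf x 2 ∧ RecastData.u WSCC9.postB_SPdamp.angleOf x 2 < π
    change 0 ≤ WSCC9.postB_SPdamp.angleOf 2 at hα0
    change WSCC9.postB_SPdamp.angleOf 2 ≤ π / 2 at hαπ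
    simp only [RecastData.u, angleOf_zero, sub_zero]
    have : (-3 / 2 : ℝ) ≤ B.a3lo := by exact_mod_cast h30
    have : (B.a3hi : ℝ) ≤ 3 := by exact_mod_cast h32
    constructor <;> linarith

end KBox

end Summit.Ventures.GridStability.Bench.WSCC9

end
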